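import Summits.CriticalPhenomena.PercolationContinuityZ3.Theorems.PercNearOneGluingNoHeavyLowerTailAntitheticHandleDual
import Summits.CriticalPhenomena.PercolationContinuityZ3.Theorems.PercNearOneGluingNoHeavyLowerTailAntitheticTransport
import Summits.CriticalPhenomena.PercolationContinuityZ3.Theorems.PercNearOneGluingNoHeavyLowerTailAntitheticBook3Oplus
import Summits.CriticalPhenomena.PercolationContinuityZ3.Theorems.PercNearOneGluingNoHeavyLowerTailAntitheticApexMixed
import HarnessLib

/-!
# `NoHeavyLowerTail` (stmt-CriticalPhenomena-4575) — antithetic cluster pairs: **THEOREM B3H — the 3-PAGE BOOK PLUS A HANDLE ALONG THE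
# SPINE** (CONJECTURE Δ2 / the vertex antithetic inequality at `R = {x}`, all arm lengths; prim-hp-2 gen 64, HOME/MEMO-gen64.md §3)

Support file (`--supports stmt-CriticalPhenomena-4575`, hull-port prover `prim-hp-2`, gen 64).  No definitions, no named facts, no sorries;
the ⊕-input …AntitheticBook3Oplus is a `native_decide`-checked certificate.  VERTEX version.

THE GRAPH.  `B₃` = three triangles on the common spine `c 1 c 2` with tips `c 0 = s`, `c 3`, `c 4` (`c : Fin 5 → V` injective; edge set
`E₀ = Sym2.map c '' {01,02,12,13,14,23,24}`), handle `P = c 1 – u 1 … u a = y – x – z = w b … w 1 – Q = c 2` between the two SPINE vertices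
(arms of fresh vertices, `a, b ≥ 0`, `x` fresh, `yz ∉ H`).  `(B₃, s, c 1)` and `(B₃, s, c 2)` are the λ = 2 OBSTRUCTIONS of HOME/MEMO-gen63.md
§5(b): `deg s = 2`, only two internally disjoint `s – P` paths, yet `{P ∈ X}` has no red-dominated box partition — so neither THEOREM Θ² nor any
box theorem reaches this family;
* `Antithetic.Book3.handle_vertex_sum_nonneg` — **THEOREM B3H**: for all monotone `F, G`,
  `0 ≤ Σ_{ω : ¬(x ∈ X_E ω ∧ x ∈ Y_E ω)} (F(X_E ω) − F(Y_E ω))·(G(X_E ω) − G(Y_E ω))`, `E = B₃ ∪ arms + xy + xz`.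
PROOF = DUAL HANDLE THEOREM with (⊕) = `Antithetic.Book3.oplus_powerset` transported along `c` and (M) = `Antithetic.Apex.mixed_nonneg`
(the spine vertex `c 2` is an apex of `B₃`).
[cite: VandenbergHaggstromKahn2005, §1 p. 6 ("Harris' inequality"), §1 p. 3 (open cluster `C_s`)]
-/

noncomputable section

namespace Summit.CriticalPhenomena.PercolationContinuityZ3.Theorems

open Literature.Probability.Percolation
open scoped Classical

namespace Antithetic

namespace Book3

variable {V : Type*} {c : Fin 5 → V} (hc : Function.Injective c) {E₀ : Set (Sym2 V)}
  (hE₀ : E₀ = Sym2.map c '' ↑({s(0, 1), s(0, 2), s(1, 2), s(1, 3), s(1, 4), s(2, 3), s(2, 4)} : Finset (Sym2 (Fin 5))))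
include hc hE₀

omit hc in
/-- The spine vertex `c 2` is an apex of the book. [this work] -/
theorem apex_spine : ∀ e ∈ E₀, ∀ v ∈ e, v ≠ c 2 → s(v, c 2) ∈ E₀ := by
  have hK : ∀ k : Fin 5, k ≠ 2 → s(k, 2) ∈ ({s(0, 1), s(0, 2), s(1, 2), s(1, 3), s(1, 4), s(2, 3), s(2, 4)} : Finset (Sym2 (Fin 5))) := by
    decide
  rw [hE₀]
  rintro f ⟨e, he, rfl⟩ v hv hv2
  induction e using Sym2.ind with
  | h i j =>
    rw [Sym2.map_mk] at hv
    have hv' : ∃ k, v = c k := by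
      rcases Sym2.mem_iff.1 hv with rfl | rfl
      · exact ⟨i, rfl⟩
      · exact ⟨j, rfl⟩
    obtain ⟨k, rfl⟩ := hv'
    exact ⟨s(k, 2), Finset.mem_coe.2 (hK k fun h => hv2 (by rw [h])), Sym2.map_mk _ _ _⟩

variable [Fintype V] {u w : ℕ → V} {a b : ℕ}
  (hu0 : u 0 = c 1) (hw0 : w 0 = c 2)
  (hufresh : ∀ i, 0 < i → i ≤ a → ∀ f ∈ E₀ ∪ Cyc.edgeSet b w, u i ∈ f → f.IsDiag)
  (hwfresh : ∀ i, 0 < i → i ≤ b → ∀ f ∈ E₀, w i ∈ f → f.IsDiag)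
  (huinj : ∀ i j, i ≤ a → j ≤ a → u i = u j → i = j) (hwinj : ∀ i j, i ≤ b → j ≤ b → w i = w j → i = j)
  (hsu : ∀ i, 0 < i → i ≤ a → c 0 ≠ u i) (hsw : ∀ i, 0 < i → i ≤ b → c 0 ≠ w i)
  (hPw : ∀ i, 0 < i → i ≤ b → c 1 ≠ w i) (hzu : ∀ i, 0 < i → i ≤ a → w b ≠ u i)
include hu0 hw0 hufresh hwfresh huinj hwinj hsu hsw hPw hzu

/-- **THEOREM B3H (3-page book + handle along the spine, all arm lengths).**  With `s = c 0` (a page tip), `P = c 1`, `Q = c 2` (the spine),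
for all monotone `F, G`: `0 ≤ Σ_{ω : ¬(x ∈ X_E ω ∧ x ∈ Y_E ω)} (F(X_E ω) − F(Y_E ω))·(G(X_E ω) − G(Y_E ω))`; the edge set is written
`(stub ∪ E₀) ∪ arm + xy + xz` (a statement about the book; cf. …AntitheticK4Handle for `K₄`). [this work] -/
theorem handle_vertex_sum_nonneg {x : V}
    (hx : ∀ f ∈ (Cyc.edgeSet b w ∪ E₀) ∪ Cyc.edgeSet a u, x ∈ f → f.IsDiag)
    (hxs : x ≠ c 0) (hxy : x ≠ u a) (hxz : x ≠ w b) (hyz : u a ≠ w b) (hg : s(u a, w b) ∉ (Cyc.edgeSet b w ∪ E₀) ∪ Cyc.edgeSet a u)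
    {F G : Set V → ℝ} (hF : Monotone F) (hG : Monotone G) :
    0 ≤ ∑ ω ∈ Finset.univ.filter (fun ω : Set (Sym2 V) =>
        ¬ ((openGraph (ω ∩ insert s(x, u a) (insert s(x, w b) ((Cyc.edgeSet b w ∪ E₀) ∪ Cyc.edgeSet a u)))).Reachable (c 0) x ∧
          (openGraph (ωᶜ ∩ insert s(x, u a) (insert s(x, w b) ((Cyc.edgeSet b w ∪ E₀) ∪ Cyc.edgeSet a u)))).Reachable (c 0) x)),
      (F (openCluster (ω ∩ insert s(x, u a) (insert s(x, w b) ((Cyc.edgeSet b w ∪ E₀) ∪ Cyc.edgeSet a u))) (c 0)) -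
          F (openCluster (ωᶜ ∩ insert s(x, u a) (insert s(x, w b) ((Cyc.edgeSet b w ∪ E₀) ∪ Cyc.edgeSet a u))) (c 0))) *
        (G (openCluster (ω ∩ insert s(x, u a) (insert s(x, w b) ((Cyc.edgeSet b w ∪ E₀) ∪ Cyc.edgeSet a u))) (c 0)) -
          G (openCluster (ωᶜ ∩ insert s(x, u a) (insert s(x, w b) ((Cyc.edgeSet b w ∪ E₀) ∪ Cyc.edgeSet a u))) (c 0))) := by
  -- (edge set `(stub ∪ E₀) ∪ arm`; the dual handle theorem writes `arm ∪ (E₀ ∪ stub)`)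
  have hcomm : (Cyc.edgeSet b w ∪ E₀) ∪ Cyc.edgeSet a u = Cyc.edgeSet a u ∪ (E₀ ∪ Cyc.edgeSet b w) := by
    rw [Set.union_comm (Cyc.edgeSet b w), Set.union_comm]
  rw [hcomm] at hx hg ⊢
  have hK : ∀ e ∈ ({s(0, 1), s(0, 2), s(1, 2), s(1, 3), s(1, 4), s(2, 3), s(2, 4)} : Finset (Sym2 (Fin 5))), ¬ e.IsDiag := by decide
  have hnd : ∀ f ∈ E₀, ¬ f.IsDiag := by
    rw [hE₀]
    rintro f ⟨e, he, rfl⟩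
    have hne := hK e (Finset.mem_coe.1 he)
    induction e using Sym2.ind with
    | h i j =>
      rw [Sym2.map_mk, Sym2.mk_isDiag_iff]
      rw [Sym2.mk_isDiag_iff] at hne
      exact fun h => hne (hc h)
  have hop := fun (K₁ K₂ : Set V → Set V → ℝ) hK₁ hso₁ hK₂ hso₂ =>
    Transport.oplus_of_powerset hc ({s(0, 1), s(0, 2), s(1, 2), s(1, 3), s(1, 4), s(2, 3), s(2, 4)} : Finset (Sym2 (Fin 5))) 0 1
      (fun L₁ L₂ hL₁ hsoL₁ hL₂ hsoL₂ => by
        convert oplus_powerset L₁ L₂ hL₁ hsoL₁ hL₂ hsoL₂ using 9)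
      hE₀ K₁ K₂ hK₁ hso₁ hK₂ hso₂
  have hmix := fun (K₁ K₂ : Set V → Set V → ℝ) hK₁ hso₁ hK₂ hso₂ =>
    Apex.mixed_nonneg (E := E₀) (s := c 0) (apex_spine hE₀) (c 1) K₁ K₂ hK₁ hso₁ hK₂ hso₂
  have h := Pendant.handle_vertex_sum_nonneg_of_oplus hnd hwfresh hwinj hsw hPw hop hu0 hw0 hufresh huinj hsu hzu hmix
    hx hxs hxy hxz hyz hg hF hG
  convert h using 3

end Book3

end Antithetic

end Summit.CriticalPhenomena.PercolationContinuityZ3.Theorems
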